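import Summits.QuantumFields.YangMills.Theorems.BalabanUVNodesN09ContinuousAxialCritCfg
import Literature.MathematicalPhysics.QuantumFieldTheory.Balaban1983to89.Node00.SmallFieldChi29AxOfRecord

/-!
# BalabanUVNodes ∕ N07–N09 junction — ROAD B's LETTER CLAUSES FOR RC-1's NAMED BLOCK-AXIAL CRITICAL CONFIGURATION `Node00.critCfgAxOfRecord`:
# `V^{(k)}_{ax}(W) = axialize (V^{(k),Sel}(W))` on the uniqueness set ⇒ CONTINUOUS on the small-field domains, Prop-2 small, measurable under uniqueness at every
# coarse field; the (2.9) cut-offs centred at it are measurable as soon as the letter is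

Cell `pub-ymgap` (YM-PLAN Track A, D-0062), width seat `pub-ymgap-dag-n07-w3` (g22; node N07 = [Balaban1985Variational] ∕ K0–K1 junction).  `--kind proof --supports stmt-QuantumFields-27364 --as helper` (K1⁹; dag-lead KEY MAP v2),
COUNT-NEUTRAL.  NEW leaf; THEOREMS ONLY — 0 `def`, 0 `sorry`, 0 `instance`, 0 `notation`; standard axioms. [I] = [Balaban1987RG1] (CMP 109), [B7] = [Balaban1985Averaging] (CMP 98), [B11] = [Balaban1985Variational] (CMP 102).

WHY.  WORK ORDER RC-1 «RE-CENTRE THE RECORD» (director-ym №462 (B)∕№463; CRIT-1 g33 Q-3 (iii)) made the (2.3) critical configuration of record BLOCK-AXIAL by NAME: `critCfgAxOfRecord ν K k := axialize (contourOfRecord F N K k) ∘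
critCfgOfRecord ν K k` ([Ax-2] ✓p796675), where `critCfgOfRecord = Ū^k ∘ Uk` still reads def-B's BARE `Classical.choose` minimiser and `axialize` is PT-A-2's explicit block-axialiser (`BlockAxialRepresentative` ✓p796010).  Road B of
node N09 (the `hreg` towers) asks of ANY letter `crit : GaugeField_{k+1} → GaugeField_k` on a small-field domain `D`: measurability, the fibre identity, Prop-2 smallness, `ContinuousOn crit D`; dag-n09-w5 g7
(`…N09ContinuousAxialCritCfg`) delivered them for an ∃-PACKAGED axial letter `ax ∘ critCfgSelOfRecord` over def-B's measurable rooted selector `UkSel`.  THIS FILE transfers that road to THE NAMED LETTER OF RECORD: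
* §1 (generic topological gauge group) `axializer cd V x` IS dag-n09-w2's explicit fine axial element ⇒ `continuousOn_axializer_apply`, ★ `continuousOn_axialize` on every set where the contour variables `V ↦ cd.holTo V y x` (`x ∈
  B(y)`) are continuous; `plaqSmall_axialize_iff`.  §2 (record) ★ `continuousOn_axialize_contourOfRecord_admissible` (Federbush- admissible set, dag-n09-w1), `…_plaqSmall` ∕ `continuousAt_…_of_plaqSmall` (`0 ≤ a`, `((d·L)²∕4)·a <
  δ_N`), `…_domAlt`.
* §3 ★★ THE HINGE `critCfgAxOfRecord_eq_axialize_critCfgSel`: for every `W` with `UniqueUkOrbit (k+1) ν.εreg W` — VACUOUS OFF the solvable set, where `Uk` and `UkSel` are both the junk `1` — `critCfgAxOfRecord ν K k W = axialize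
  (contourOfRecord F N K k) (critCfgSelOfRecord ν K k W)` (PT-A-2 `critCfgAxOfRecord_eq_of_orbitRel` + def-B `orbitRel_Uk_UkSel`; unsolvable case `critCfgOfRecord_of_not` ∕ `UkSel_of_not`); `EqOn` ∕ `funext` ∕ two-radii forms.
* §4 Prop-2 smallness: `plaqSmall_critCfgAxOfRecord_iff` (⇔ the bare letter's, unconditionally), `…_iff_sel`, ★ `plaqSmall_critCfgAxOfRecord_of_ukExists` (dag-n09-w3∕n21-c).
* §5 MEASURABILITY: `measurable_axialize_critCfgSel` (composite, UNCONDITIONAL); ★ `measurable_critCfgAxOfRecord_of_forall_uniqueOrbit`; for any proof of `Measurable (critCfgAxOfRecord ν K k)`: `measurable_fluctDevAxOfRecord_of`, ★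
  `measurable_chiFix29AxOfRecord_of` ∕ `…All…_of` ∕ `measurable_chiFixed29Ax_of` ([Ax-2]'s cut-offs, [Ax-3a]'s β-slot χ).  LOCATED (for the RC-1 custodians ∕ CRIT-1; not a defect of any
  filed text): the bare choice survives in `critCfgAxOfRecord` EXACTLY on «solvable ∖ unique-orbit» coarse data, so without uniqueness at EVERY `W` the tree has no proof of `Measurable (critCfgAxOfRecord ν K k)` or of the Ax cut-offs
  (PT-A-2's `measurable_critCfgAxOfRecord_of` displays `Measurable (Uk …)` for the same reason); the composite `axialize ∘ critCfgSelOfRecord` is measurable outright and agrees with the named letter wherever [B11] Thm 1 gives one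
  orbit, and off the solvable set.  Continuity ON the domains is unaffected.
* §6 CONTINUITY: ★★ `continuousOn_critCfgAxOfRecord_of_continuousOn_sel` (`D ⊆ {UniqueUkOrbit}`, Sel letter continuous with `a`-small values, Federbush letter), `…_of_ukExists` (smallness by Prop 2), ★★★
  `continuousOn_critCfgAxOfRecord_of_thm1_of_reg8` (selector continuity DISCHARGED by dag-n09-w1 g6's two-radii Berge theorem: [B11] Thm 1 ×2 at `εbg` + (8)-membership on `D`, `εreg < εbg`, `εreg < α₀`, `α₀` admissible (53) + two
  loop-guard rows, `0 < εreg`, (53) pair at `εreg`, `2εreg ≤ δ·L²`, `((d·L)²∕4)·δ < δ_N`), ★★ `hcritAx_domAlt_of_thm1_εbg_of_reg8` — dag-n09-w1 g5's TOWER BINDER `hcrit` IN THE Ax EDITION OF RECORD `∀ j < K, ContinuousOn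
  (critCfgAxOfRecord F N ν K j) (domAlt_{j+1})`.
* §7 ★★★ `critCfgAxOfRecord_roadB_clauses_of_thm1_of_reg8`: fibre identity · axial gauge · (181)-covariance · `EqOn` with the measurable composite · smallness · `ContinuousOn`.

HONEST FRAMING (binding).  Count-neutral kernel topology ∕ gauge algebra ∕ measurability BY NAME over NODE 00's definitions (def-B, K0c∕K0e, PT-A-2) and dag-n09-w1∕w3∕w5's Berge ∕ Federbush ∕ Prop-2 theorems; [B11] Theorem 1 enters
ONLY as displayed hypotheses (`UniqueUkOrbit`, `h11`, `hreg8`) — NOTHING of Bałaban's analysis asserted, ported or discharged; no body of record edited, no name re-pointed (body-freeze №460 (2) honoured); no estimate; N07 ∕ N09 NOT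
discharged; K0⁷ ∕ K1⁹ ∕ K3⁸ (as vetted: choice-centred) and the unborn K-Ax texts NOT closed; counts unmoved (8∕28 · K 1∕4); one finite four-torus programme at fixed `ε = L^{−K}` per run — R4 closes the CONDITIONAL rung
`BalabanLadder.UV` only; NOT ℝ⁴ ∕ infinite volume ∕ OS; the Yang–Mills mass gap (Clay) is NOT proved by any of this. 
-/

noncomputable section

open Set Filter Topology MeasureTheory

namespace Summit.QuantumFields.YangMills.BalabanUVNodes.N07CritCfgAxOfRecordClauses

open Literature.MathematicalPhysics.QuantumFieldTheory.Balaban1983to89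
open Literature.MathematicalPhysics.QuantumFieldTheory.Balaban1983to89.Node00
open Literature.MathematicalPhysics.QuantumFieldTheory.Balaban1983to89.T4Continuum (T4Family)
open Literature.MathematicalPhysics.QuantumFieldTheory.Balaban1983to89.ExpMeanLog (deltaSU)
open Literature.MathematicalPhysics.QuantumFieldTheory.Balaban1983to89.FederbushMean
open Literature.MathematicalPhysics.QuantumFieldTheory.Balaban1983to89.BlockAveragingTwoLevel (stairHol offsetOf)
open BlockAxialRepresentative (axializer axialize axialize_def)
open B12RTGaugeInvariance254 (liftTransf)
open B12GaugeOrbits021 (OrbitRel plaqSmall_gaugeAct_iff')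
open GaugeField (gaugeAct)
open Summit.QuantumFields.YangMills.BalabanUVNodes.N09ContinuousAxialCritCfg
  (continuousOn_holTo_contourOfRecord_admissible setOf_plaqSmall_subset_admissible domAltOfRecord_subset_admissible)
open Summit.QuantumFields.YangMills.BalabanUVNodes.N09SelectorContinuousOfThm1TwoRadii (continuousOn_critCfgSelOfRecord_of_thm1_of_reg8)
open Summit.QuantumFields.YangMills.BalabanUVNodes.N09LocalSupportSetAnyCrit (hcritSel_of_ukExists)
open Summit.QuantumFields.YangMills.BalabanUVNodes.N09BackgroundRadiiTransfer (ukExists_of_le_of_Uk_mem uniqueUkOrbit_of_le_of_Uk_mem)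

/-! ## §1  Generic topological gauge group: PT-A-2's `axializer`∕`axialize` are continuous wherever the contour variables are -/
section Generic

variable {P : Params} {j : ℕ} {G : Type*} [GaugeGroup G] [TopologicalSpace G] [ContinuousMul G] [ContinuousInv G]

omit [ContinuousMul G] [ContinuousInv G] in
/-- **Each value `V ↦ axializer cd V x` of the block-axialiser is continuous on every set `A` on which the contour variables `V ↦ U(y, x)`, `x ∈ B(y)`, are** — the axialiser is `1` at a block centre and the block contour `cd.holTo V
(blockOf x) x` elsewhere (dag-n09-w2's explicit fine axial element, token for token). [cite: Balaban1987RG1, p.265 (2.2)–(2.3) and (0.11) p.253 (bookkeeping)] -/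
theorem continuousOn_axializer_apply (cd : ContourData P j G) {A : Set (GaugeField P j G)}
    (hcd : ∀ (y : Site P (j + 1)), ∀ x ∈ block y, ContinuousOn (fun V : GaugeField P j G => cd.holTo V y x) A) (x : Site P j) :
    ContinuousOn (fun V : GaugeField P j G => axializer cd V x) A := by
  by_cases hx : x = emb (blockOf x)
  · simp only [axializer, if_pos hx]
    exact continuousOn_const
  · simp only [axializer, if_neg hx]
    exact hcd (blockOf x) x (by simp [block])

/-- ★ **THE BLOCK-AXIAL REPRESENTATIVE `axialize cd` IS CONTINUOUS ON EVERY SET ON WHICH THE CONTOUR VARIABLES ARE** (bondwise products and inverses of continuous factors in a topological group). [cite: Balaban1987RG1, p.265 (2.3);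
Balaban1985Averaging, (8) p.19 (bookkeeping)] -/
theorem continuousOn_axialize (cd : ContourData P j G) {A : Set (GaugeField P j G)}
    (hcd : ∀ (y : Site P (j + 1)), ∀ x ∈ block y, ContinuousOn (fun V : GaugeField P j G => cd.holTo V y x) A) :
    ContinuousOn (axialize cd) A := by
  refine continuousOn_pi.2 fun b => ?_
  have hb : ContinuousOn (fun V : GaugeField P j G => V b) A := (continuous_apply b).continuousOn
  show ContinuousOn (fun V : GaugeField P j G => axializer cd V b.src * V b * (axializer cd V b.tgt)⁻¹) A
  exact ((continuousOn_axializer_apply cd hcd b.src).mul hb).mul (continuousOn_axializer_apply cd hcd b.tgt).inv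

omit [TopologicalSpace G] [ContinuousMul G] [ContinuousInv G] in
/-- The representative is a gauge image, so every plaquette letter is unchanged: `PlaqSmall δ (axialize cd V) ↔ PlaqSmall δ V` (`dist1` is conjugation invariant). [cite: Balaban1987RG1, p.265 (2.3); Balaban1985Variational, (2) p.278
(bookkeeping)] -/
theorem plaqSmall_axialize_iff (cd : ContourData P j G) (δ : ℝ) (V : GaugeField P j G) : PlaqSmall δ (axialize cd V) ↔ PlaqSmall δ V := by
  rw [axialize_def]
  exact plaqSmall_gaugeAct_iff' δ _ V
end Generic

/-! ## §2  The record: `axialize (contourOfRecord F N K k)` is continuous on the Federbush-admissible set, hence on every small-plaquette class and on the small-field domains -/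
section Record

variable {F : T4Family} {N : ℕ} [NeZero N]
/-- ★ **`axialize (contourOfRecord F N K k)` IS CONTINUOUS ON THE FEDERBUSH-ADMISSIBLE SET OF STEP `k`** (every staircase family `{U(Γ^σ_{y,x})}_σ`, `x ∈ B(y)`, `δ_N`-admissible — where def-B's averaged contour variables (0.11) are
continuous, dag-n09-w1 ∕ dag-n09-w5). [cite: Balaban1987RG1, (0.10)–(0.11) p.253 and (2.3) p.265] -/
theorem continuousOn_axialize_contourOfRecord_admissible (K k : ℕ) :
    ContinuousOn (axialize (contourOfRecord F N K k))
      {U : GaugeField (F.P K) k (SU N) | ∀ y : Site (F.P K) (k + 1), ∀ x ∈ block y,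
        (federbushSU (n := Fin N)).Adm (stairHol U y (offsetOf y x))} :=
  continuousOn_axialize _ fun y _ hx => continuousOn_holTo_contourOfRecord_admissible K k y hx

/-- **… hence on every small-plaquette class `{PlaqSmall a}`** with `0 ≤ a` and the Federbush letter `((d·L)²∕4)·a < δ_N` (standing range `k + 1 ≤ m + K`). [cite: Balaban1987RG1, (0.5) and (0.11) p.253, (2.3) p.265] -/
theorem continuousOn_axialize_contourOfRecord_plaqSmall {K k : ℕ} (hk : k + 1 ≤ (F.P K).m + (F.P K).K) {a : ℝ} (ha : 0 ≤ a)
    (hnum : ((((F.P K).d * (F.P K).L : ℕ) : ℝ)) ^ 2 / 4 * a < deltaFed (Fin N)) :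
    ContinuousOn (axialize (contourOfRecord F N K k)) {U : GaugeField (F.P K) k (SU N) | PlaqSmall a U} :=
  (continuousOn_axialize_contourOfRecord_admissible K k).mono (setOf_plaqSmall_subset_admissible hk ha hnum)

/-- **… hence continuous AT every `a`-small configuration** (the strict plaquette class is open). [cite: Balaban1987RG1, (0.11) p.253 and (2.3) p.265] -/
theorem continuousAt_axialize_contourOfRecord_of_plaqSmall {K k : ℕ} (hk : k + 1 ≤ (F.P K).m + (F.P K).K) {a : ℝ} (ha : 0 ≤ a)
    (hnum : ((((F.P K).d * (F.P K).L : ℕ) : ℝ)) ^ 2 / 4 * a < deltaFed (Fin N)) {U : GaugeField (F.P K) k (SU N)} (hU : PlaqSmall a U) :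
    ContinuousAt (axialize (contourOfRecord F N K k)) U :=
  (continuousOn_axialize_contourOfRecord_plaqSmall hk ha hnum).continuousAt ((isOpen_plaqSmall a).mem_nhds hU)

/-- **… and on the small-field domain of record `domAltOfRecord ν K k = {PlaqSmall ν.ε₀}`** once `0 ≤ ν.ε₀` and `((d·L)²∕4)·ν.ε₀ < δ_N`. [cite: Balaban1987RG1, p.259 and (0.11) p.253, (2.3) p.265] -/
theorem continuousOn_axialize_contourOfRecord_domAlt (ν : Stage7Numerics) {K k : ℕ} (hk : k + 1 ≤ (F.P K).m + (F.P K).K) (hε : 0 ≤ ν.ε₀)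
    (hnum : ((((F.P K).d * (F.P K).L : ℕ) : ℝ)) ^ 2 / 4 * ν.ε₀ < deltaFed (Fin N)) :
    ContinuousOn (axialize (contourOfRecord F N K k)) (domAltOfRecord F N ν K k) :=
  (continuousOn_axialize_contourOfRecord_admissible K k).mono (domAltOfRecord_subset_admissible ν hk hε hnum)
end Record

/-! ## §3  THE HINGE: on the uniqueness set the named block-axial letter is the axialised Sel letter -/
section Hinge

variable {F : T4Family} {N : ℕ} [NeZero N]
/-- ★★ **`V^{(k)}_{ax}(W) = axialize (V^{(k),Sel}(W))` WHEREVER THE MINIMAL ORBIT IS UNIQUE** (standing range `k + 1 ≤ m + K`).  On the solvable set the bare choice `Uk … W` and def-B's rooted selector `UkSel … W` lie in one residual orbit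
of level `k + 1` (`orbitRel_Uk_UkSel`), and the axialised k-fold average is orbit-blind (PT-A-2's `critCfgAxOfRecord_eq_of_orbitRel`); OFF the solvable set `UniqueUkOrbit` holds vacuously and BOTH selections are the junk `1`, so both
sides read `axialize (Ū^k 1)`. [cite: Balaban1987RG1, (2.2)–(2.3) p.265 and (0.21) p.256; Balaban1985Variational, Thm 1 p.279] -/
theorem critCfgAxOfRecord_eq_axialize_critCfgSel {ν : Stage7Numerics} {K k : ℕ} (hk : k + 1 ≤ (F.P K).m + (F.P K).K)
    {W : GaugeField (F.P K) (k + 1) (SU N)} (hu : UniqueUkOrbit F N K (k + 1) ν.εreg W) :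
    critCfgAxOfRecord F N ν K k W = axialize (contourOfRecord F N K k) (critCfgSelOfRecord F N ν K k W) := by
  by_cases h : UkExists F N K (k + 1) ν.εreg W
  · rw [critCfgSelOfRecord_def]
    exact critCfgAxOfRecord_eq_of_orbitRel (Nat.le_of_succ_le hk) (orbitRel_Uk_UkSel hk h hu)
  · rw [critCfgAxOfRecord_def, critCfgOfRecord_of_not h, critCfgSelOfRecord_def, UkSel_of_not h]

/-- The same as an `EqOn` on every set of coarse data with one minimal orbit at each of its points (vacuous off the solvable set). [cite: Balaban1987RG1, (2.3) p.265; Balaban1985Variational, Thm 1 p.279] -/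
theorem eqOn_critCfgAxOfRecord_axialize_critCfgSel {ν : Stage7Numerics} {K k : ℕ} (hk : k + 1 ≤ (F.P K).m + (F.P K).K)
    {D : Set (GaugeField (F.P K) (k + 1) (SU N))} (hu : ∀ W ∈ D, UniqueUkOrbit F N K (k + 1) ν.εreg W) :
    EqOn (critCfgAxOfRecord F N ν K k) (fun W => axialize (contourOfRecord F N K k) (critCfgSelOfRecord F N ν K k W)) D :=
  fun W hW => critCfgAxOfRecord_eq_axialize_critCfgSel hk (hu W hW)

/-- Under uniqueness of the minimal orbit AT EVERY coarse field the two letters are one function.  (Honest: [B11] Thm 1 gives uniqueness only for REGULAR data; this global form is a hypothesis the tree cannot discharge in general — see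
§5's located note.) [cite: Balaban1987RG1, (2.3) p.265; Balaban1985Variational, Thm 1 p.279] -/
theorem critCfgAxOfRecord_eq_of_forall_uniqueOrbit {ν : Stage7Numerics} {K k : ℕ} (hk : k + 1 ≤ (F.P K).m + (F.P K).K)
    (hu : ∀ W : GaugeField (F.P K) (k + 1) (SU N), UniqueUkOrbit F N K (k + 1) ν.εreg W) :
    critCfgAxOfRecord F N ν K k = fun W => axialize (contourOfRecord F N K k) (critCfgSelOfRecord F N ν K k W) :=
  funext fun W => critCfgAxOfRecord_eq_axialize_critCfgSel hk (hu W)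

/-- In the two-radii currency of dag-n09-w1 ([B11] Thm 1 at the background radius `εbg` + the (8)-membership `Uk εbg W ∈ bgReg εreg`, `εreg ≤ εbg`): the hinge holds at `W`. [cite: Balaban1985Variational, Thm 1 (6), (8) p.279;
Balaban1987RG1, (1.1) p.260 and (2.3) p.265] -/
theorem critCfgAxOfRecord_eq_axialize_critCfgSel_of_thm1_of_reg8 {ν : Stage7Numerics} {K k : ℕ} (hk : k + 1 ≤ (F.P K).m + (F.P K).K) {εbg : ℝ}
    (hle : ν.εreg ≤ εbg) {W : GaugeField (F.P K) (k + 1) (SU N)} (hex : UkExists F N K (k + 1) εbg W) (huniq : UniqueUkOrbit F N K (k + 1) εbg W)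
    (hreg8 : Uk F N K (k + 1) εbg W ∈ bgReg F N K (k + 1) ν.εreg) :
    critCfgAxOfRecord F N ν K k W = axialize (contourOfRecord F N K k) (critCfgSelOfRecord F N ν K k W) :=
  critCfgAxOfRecord_eq_axialize_critCfgSel hk (uniqueUkOrbit_of_le_of_Uk_mem hle hex hreg8 huniq)
end Hinge

/-! ## §4  Prop-2 smallness of the named letter -/
section Smallness

variable {F : T4Family} {N : ℕ} [NeZero N]
/-- **The plaquette letters of `V^{(k)}_{ax}(W)` are those of the bare `V^{(k)}(W)`** — unconditionally (`axialize` is a gauge image). [cite: Balaban1987RG1, (2.3) p.265; Balaban1985Averaging, (53) p.26 (bookkeeping)] -/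
theorem plaqSmall_critCfgAxOfRecord_iff (ν : Stage7Numerics) (K k : ℕ) (δ : ℝ) (W : GaugeField (F.P K) (k + 1) (SU N)) :
    PlaqSmall δ (critCfgAxOfRecord F N ν K k W) ↔ PlaqSmall δ (critCfgOfRecord F N ν K k W) := by
  rw [critCfgAxOfRecord_def]
  exact plaqSmall_axialize_iff _ δ _

/-- **… and those of the Sel letter on the uniqueness set.** [cite: Balaban1987RG1, (2.3) p.265; Balaban1985Averaging, (53) p.26 (bookkeeping)] -/
theorem plaqSmall_critCfgAxOfRecord_iff_sel {ν : Stage7Numerics} {K k : ℕ} (hk : k + 1 ≤ (F.P K).m + (F.P K).K) (δ : ℝ)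
    {W : GaugeField (F.P K) (k + 1) (SU N)} (hu : UniqueUkOrbit F N K (k + 1) ν.εreg W) :
    PlaqSmall δ (critCfgAxOfRecord F N ν K k W) ↔ PlaqSmall δ (critCfgSelOfRecord F N ν K k W) := by
  rw [critCfgAxOfRecord_eq_axialize_critCfgSel hk hu]
  exact plaqSmall_axialize_iff _ δ _

/-- ★ **PROP. 2 SMALLNESS OF THE NAMED BLOCK-AXIAL LETTER ON THE SOLVABLE SET**: `PlaqSmall δ (V^{(k)}_{ax}(W))` for every `W` solvable at the cut-off's radius `ν.εreg` and every `δ` with `2εreg ≤ δ·L²`, under `0 < εreg` and the (53) pair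
at `εreg` (dag-n21-c's [B7] Prop. 2 at NODE 00's averaging through dag-n09-w3's `hcrit_of_ukExists`, then §4's gauge invariance). [cite: Balaban1985Averaging, Prop. 2 (53) p.26; Balaban1987RG1, (2.3) p.265 and (2.9) p.266] -/
theorem plaqSmall_critCfgAxOfRecord_of_ukExists (ν : Stage7Numerics) {K k : ℕ} {δ : ℝ} (hε : 0 < ν.εreg)
    (hε3 : (143 * (((((F.P K).d + 4 : ℕ) : ℝ)) ^ 2 / 4) ^ 2) * ν.εreg ≤ 1 / 3)
    (hε2 : 2 * ν.εreg ≤ 2 * deltaSU (Fin N) / ((((F.P K).d + 4) * (F.P K).L : ℕ) : ℝ) ^ 2) (hδ : 2 * ν.εreg ≤ δ * ((F.P K).L : ℝ) ^ 2)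
    {W : GaugeField (F.P K) (k + 1) (SU N)} (hW : UkExists F N K (k + 1) ν.εreg W) : PlaqSmall δ (critCfgAxOfRecord F N ν K k W) :=
  (plaqSmall_critCfgAxOfRecord_iff ν K k δ W).2 (N09NestingOfHierAxial.hcrit_of_ukExists ν hε hε3 hε2 hδ hW)
end Smallness

/-! ## §5  Measurability: the composite outright; the named letter and its (2.9) cut-offs under uniqueness at every coarse field -/
section Measurability

variable {F : T4Family} {N : ℕ} [NeZero N]
/-- **The composite `W ↦ axialize (V^{(k),Sel}(W))` is MEASURABLE — no hypothesis** (def-B's `measurable_UkSel` through `measurable_critCfgSelOfRecord`, PT-A-2's `measurable_axialize` at the measurable contour variables of record). [cite: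
Balaban1987RG1, (0.11) p.253 and (2.3) p.265 (bookkeeping)] -/
theorem measurable_axialize_critCfgSel (ν : Stage7Numerics) (K k : ℕ) :
    Measurable fun W : GaugeField (F.P K) (k + 1) (SU N) => axialize (contourOfRecord F N K k) (critCfgSelOfRecord F N ν K k W) :=
  (BlockAxialRepresentative.measurable_axialize _ (measurable_holTo_contourOfRecord F N K k)).comp (measurable_critCfgSelOfRecord ν K k)

/-- ★ **THE NAMED LETTER `critCfgAxOfRecord ν K k` IS MEASURABLE UNDER UNIQUENESS OF THE MINIMAL ORBIT AT EVERY COARSE FIELD** (then it IS the composite, §3). LOCATED (honest): uniqueness at every `W` is NOT [B11] Thm 1 (regular data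
only); on «solvable ∖ unique-orbit» data the bare `Classical.choose` survives inside `critCfgAxOfRecord` and the tree has no measurability proof there — PT-A-2's `measurable_critCfgAxOfRecord_of` displays `Measurable (Uk …)` for the
same reason. [cite: Balaban1987RG1, (2.3) p.265; Balaban1985Variational, Thm 1 p.279] -/
theorem measurable_critCfgAxOfRecord_of_forall_uniqueOrbit (ν : Stage7Numerics) {K k : ℕ} (hk : k + 1 ≤ (F.P K).m + (F.P K).K)
    (hu : ∀ W : GaugeField (F.P K) (k + 1) (SU N), UniqueUkOrbit F N K (k + 1) ν.εreg W) :
    Measurable (critCfgAxOfRecord F N ν K k) := by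
  rw [critCfgAxOfRecord_eq_of_forall_uniqueOrbit hk hu]
  exact measurable_axialize_critCfgSel ν K k

/-- **The axial-centred fluctuation deviation at a bond is measurable in `V` AS SOON AS the named letter is** (the averaging of record, the group operations and `dist1` are measurable). [cite: Balaban1987RG1, (2.9) p.266 (bookkeeping)] -/
theorem measurable_fluctDevAxOfRecord_of {ν : Stage7Numerics} {K k : ℕ} (hcrit : Measurable (critCfgAxOfRecord F N ν K k)) (b : PBond (F.P K) k) :
    Measurable (fun V : GaugeField (F.P K) k (SU N) => fluctDevAxOfRecord F N ν K k V b) := by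
  have hc : Measurable (fun V : GaugeField (F.P K) k (SU N) => critCfgAxOfRecord F N ν K k ((avOfRecord F N K k).avg V) b) :=
    (measurable_pi_apply b).comp (hcrit.comp (avOfRecord_measurable F N K k))
  have hV : Measurable (fun V : GaugeField (F.P K) k (SU N) => V b) := measurable_pi_apply b
  have h : (fun V : GaugeField (F.P K) k (SU N) => fluctDevAxOfRecord F N ν K k V b) =
      fun V => dist1 ((critCfgAxOfRecord F N ν K k ((avOfRecord F N K k).avg V) b)⁻¹ * V b) :=
    funext fun V => fluctDevAxOfRecord_apply ν K k V b
  rw [h]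
  exact RegularGaugeGroup.measurable_dist1.comp (hc.inv.mul hV)

/-- **`χ^{(2.9),all}_{k,ax}` IS MEASURABLE AS SOON AS the named letter is.** [cite: Balaban1987RG1, (2.9) p.266 (bookkeeping)] -/
theorem measurable_chiFix29AllAxOfRecord_of {ν : Stage7Numerics} (ε₁ : ℝ) {K k : ℕ} (hcrit : Measurable (critCfgAxOfRecord F N ν K k)) :
    Measurable (chiFix29AllAxOfRecord F N ν ε₁ K k) := by
  have hS : MeasurableSet {V : GaugeField (F.P K) k (SU N) | ∀ b : PBond (F.P K) k, fluctDevAxOfRecord F N ν K k V b < ε₁} := by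
    have h : {V : GaugeField (F.P K) k (SU N) | ∀ b : PBond (F.P K) k, fluctDevAxOfRecord F N ν K k V b < ε₁} =
        ⋂ b : PBond (F.P K) k, {V | fluctDevAxOfRecord F N ν K k V b < ε₁} := by
      ext V
      simp only [mem_setOf_eq, mem_iInter]
    rw [h]
    exact MeasurableSet.iInter fun b => measurableSet_lt (measurable_fluctDevAxOfRecord_of hcrit b) measurable_const
  unfold chiFix29AllAxOfRecord
  exact Measurable.ite hS measurable_const measurable_const

/-- ★ **`χ^{(2.9)}_{k,ax}` (AS PRINTED, bonds `b₀(c)` excluded) IS MEASURABLE AS SOON AS the named letter is.** [cite: Balaban1987RG1, (2.9) p.266 (bookkeeping)] -/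
theorem measurable_chiFix29AxOfRecord_of {ν : Stage7Numerics} (ε₁ : ℝ) {K k : ℕ} (hcrit : Measurable (critCfgAxOfRecord F N ν K k)) :
    Measurable (chiFix29AxOfRecord F N ν ε₁ K k) := by
  classical
  have hS : MeasurableSet {V : GaugeField (F.P K) k (SU N) | ∀ b : PBond (F.P K) k, ¬ IsB0 b → fluctDevAxOfRecord F N ν K k V b < ε₁} := by
    have h : {V : GaugeField (F.P K) k (SU N) | ∀ b : PBond (F.P K) k, ¬ IsB0 b → fluctDevAxOfRecord F N ν K k V b < ε₁} =
        ⋂ b : PBond (F.P K) k, {V | ¬ IsB0 b → fluctDevAxOfRecord F N ν K k V b < ε₁} := by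
      ext V
      simp only [mem_setOf_eq, mem_iInter]
    rw [h]
    refine MeasurableSet.iInter fun b => ?_
    by_cases hb : IsB0 b
    · have : {V : GaugeField (F.P K) k (SU N) | ¬ IsB0 b → fluctDevAxOfRecord F N ν K k V b < ε₁} = univ :=
        eq_univ_of_forall fun V h0 => absurd hb h0
      rw [this]
      exact MeasurableSet.univ
    · have : {V : GaugeField (F.P K) k (SU N) | ¬ IsB0 b → fluctDevAxOfRecord F N ν K k V b < ε₁} =
          {V | fluctDevAxOfRecord F N ν K k V b < ε₁} := by
        ext V
        simp only [mem_setOf_eq]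
        exact ⟨fun h => h hb, fun h _ => h⟩
      rw [this]
      exact measurableSet_lt (measurable_fluctDevAxOfRecord_of hcrit b) measurable_const
  unfold chiFix29AxOfRecord
  exact Measurable.ite hS measurable_const measurable_const

/-- **The β-slot χ of [Ax-3a], `chiFixed29Ax ν ε₁ K g k`, is measurable as soon as the named letter is** (coupling-blind by typing). [cite: Balaban1987RG1, (0.19) p.256 and (2.9) p.266 (bookkeeping)] -/
theorem measurable_chiFixed29Ax_of {ν : Stage7Numerics} (ε₁ : ℝ) {K k : ℕ} (g : ℕ → ℝ) (hcrit : Measurable (critCfgAxOfRecord F N ν K k)) :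
    Measurable (chiFixed29Ax F N ν ε₁ K g k) := by
  rw [chiFixed29Ax_apply]
  exact measurable_chiFix29AxOfRecord_of ε₁ hcrit
end Measurability

/-! ## §6  Continuity of the named letter on the small-field domains -/
section Continuity

variable {F : T4Family} {N : ℕ} [NeZero N]
/-- ★★ **`V^{(k)}_{ax}` IS CONTINUOUS ON EVERY SET OF UNIQUE-ORBIT DATA WHERE THE Sel LETTER IS CONTINUOUS WITH SMALL VALUES**: `D ⊆ {UniqueUkOrbit (k+1) ν.εreg}`, `ContinuousOn (V^{(k),Sel}) D`, `∀ W ∈ D, PlaqSmall a (V^{(k),Sel} W)` with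
`0 ≤ a` and the Federbush letter `((d·L)²∕4)·a < δ_N` ⟹ `ContinuousOn (critCfgAxOfRecord ν K k) D` (§3 hinge + §2: `axialize` is continuous on the admissible set, which contains the Sel letter's values). [cite: Balaban1987RG1, (2.3)
p.265 and (0.11) p.253; Balaban1985Variational, Thm 1 p.279] -/
theorem continuousOn_critCfgAxOfRecord_of_continuousOn_sel (ν : Stage7Numerics) {K k : ℕ} (hk : k + 1 ≤ (F.P K).m + (F.P K).K)
    {D : Set (GaugeField (F.P K) (k + 1) (SU N))} {a : ℝ} (ha : 0 ≤ a)
    (hnum : ((((F.P K).d * (F.P K).L : ℕ) : ℝ)) ^ 2 / 4 * a < deltaFed (Fin N))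
    (hu : ∀ W ∈ D, UniqueUkOrbit F N K (k + 1) ν.εreg W)
    (hsm : ∀ W ∈ D, PlaqSmall a (critCfgSelOfRecord F N ν K k W))
    (hsel : ContinuousOn (critCfgSelOfRecord F N ν K k) D) :
    ContinuousOn (critCfgAxOfRecord F N ν K k) D :=
  ((continuousOn_axialize_contourOfRecord_plaqSmall hk ha hnum).comp hsel fun W hW => hsm W hW).congr
    (eqOn_critCfgAxOfRecord_axialize_critCfgSel hk hu)

/-- ★★ **THE SAME WITH THE SMALLNESS ROW DISCHARGED BY PROP. 2** on solvable data (`k < K`; `0 < εreg`, the (53) pair at `εreg`, `2εreg ≤ δ·L²`, `((d·L)²∕4)·δ < δ_N`; dag-n09-w3's `hcritSel_of_ukExists`): uniqueness + solvability +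
selector continuity on `D` ⟹ `ContinuousOn (critCfgAxOfRecord ν K k) D`. [cite: Balaban1987RG1, (2.3) p.265; Balaban1985Averaging, Prop. 2 (53) p.26; Balaban1985Variational, Thm 1 p.279] -/
theorem continuousOn_critCfgAxOfRecord_of_continuousOn_sel_of_ukExists (ν : Stage7Numerics) {K k : ℕ} (hk : k < K) {δ : ℝ} (hε : 0 < ν.εreg)
    (hε3 : (143 * (((((F.P K).d + 4 : ℕ) : ℝ)) ^ 2 / 4) ^ 2) * ν.εreg ≤ 1 / 3)
    (hε2 : 2 * ν.εreg ≤ 2 * deltaSU (Fin N) / ((((F.P K).d + 4) * (F.P K).L : ℕ) : ℝ) ^ 2) (hδ : 2 * ν.εreg ≤ δ * ((F.P K).L : ℝ) ^ 2)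
    (hnum : ((((F.P K).d * (F.P K).L : ℕ) : ℝ)) ^ 2 / 4 * δ < deltaFed (Fin N))
    {D : Set (GaugeField (F.P K) (k + 1) (SU N))} (hsol : ∀ W ∈ D, UkExists F N K (k + 1) ν.εreg W)
    (hu : ∀ W ∈ D, UniqueUkOrbit F N K (k + 1) ν.εreg W) (hsel : ContinuousOn (critCfgSelOfRecord F N ν K k) D) :
    ContinuousOn (critCfgAxOfRecord F N ν K k) D := by
  have hk1 : k + 1 ≤ (F.P K).m + (F.P K).K := by simp only [T4Family.P_K]; omega
  have hL0 : (0 : ℝ) < (F.P K).L := by exact_mod_cast (F.P K).L_pos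
  have hδ0 : 0 ≤ δ := by
    have h2 : 0 ≤ δ * ((F.P K).L : ℝ) ^ 2 := le_trans (by positivity) hδ
    exact nonneg_of_mul_nonneg_left h2 (by positivity)
  exact continuousOn_critCfgAxOfRecord_of_continuousOn_sel ν hk1 hδ0 hnum hu
    (fun W hW => hcritSel_of_ukExists ν hk hε hε3 hε2 hδ (hsol W hW)) hsel

/-- ★★★ **`V^{(k)}_{ax}` IS CONTINUOUS ON EVERY SET CARRYING THE TWO-RADII [B11] BINDERS — selector continuity DISCHARGED** (dag-n09-w1 g6's Berge theorem `continuousOn_critCfgSelOfRecord_of_thm1_of_reg8`): on `D` with [B11] Thm 1 ×2 at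
the background radius `εbg` (`h11`) and the (8)-membership `Uk εbg W ∈ bgReg εreg` (`hreg8`), under `εreg < εbg`, `εreg < α₀`, `α₀` admissible as in (53) + the two loop-guard rows on `2α₀`, `0 < εreg`, the (53) pair at `εreg`, `2εreg ≤
δ·L²`, `((d·L)²∕4)·δ < δ_N`, `k < K`: `ContinuousOn (critCfgAxOfRecord F N ν K k) D`.  Solvability and uniqueness at `εreg` on `D` come down the radius (dag-n09-w1's transfer lemmas, no extra binder). [cite: Balaban1987RG1, (2.3)
p.265; Balaban1985Variational, Thm 1 (6), (8) p.279 and (181) p.307; Balaban1985Averaging, Prop. 2 (53) p.26] -/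
theorem continuousOn_critCfgAxOfRecord_of_thm1_of_reg8 (ν : Stage7Numerics) {K k : ℕ} (hk : k < K) {εbg α₀ δ : ℝ} (hlt : ν.εreg < εbg) (he : ν.εreg < α₀)
    (hα : 0 < α₀) (hα3 : (143 * (((((F.P K).d + 4 : ℕ) : ℝ)) ^ 2 / 4) ^ 2) * α₀ ≤ 1 / 3)
    (hα2 : 2 * α₀ ≤ 2 * deltaSU (Fin N) / ((((F.P K).d + 4) * (F.P K).L : ℕ) : ℝ) ^ 2)
    (hα24 : ((((F.P K).d + 2) * (F.P K).L : ℕ) : ℝ) ^ 2 / 4 * (2 * α₀) ≤ 1 / 24)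
    (hαL : 157 * (((((F.P K).d + 2) * (F.P K).L : ℕ) : ℝ) ^ 2 / 4 * (2 * α₀)) < (((F.P K).L : ℝ) ^ ((F.P K).d - 1))⁻¹)
    (hε : 0 < ν.εreg) (hε3 : (143 * (((((F.P K).d + 4 : ℕ) : ℝ)) ^ 2 / 4) ^ 2) * ν.εreg ≤ 1 / 3)
    (hε2 : 2 * ν.εreg ≤ 2 * deltaSU (Fin N) / ((((F.P K).d + 4) * (F.P K).L : ℕ) : ℝ) ^ 2) (hδ : 2 * ν.εreg ≤ δ * ((F.P K).L : ℝ) ^ 2)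
    (hnum : ((((F.P K).d * (F.P K).L : ℕ) : ℝ)) ^ 2 / 4 * δ < deltaFed (Fin N))
    {D : Set (GaugeField (F.P K) (k + 1) (SU N))}
    (h11 : ∀ W ∈ D, UkExists F N K (k + 1) εbg W ∧ UniqueUkOrbit F N K (k + 1) εbg W)
    (hreg8 : ∀ W ∈ D, Uk F N K (k + 1) εbg W ∈ bgReg F N K (k + 1) ν.εreg) :
    ContinuousOn (critCfgAxOfRecord F N ν K k) D := by
  have hk1 : k + 1 ≤ (F.P K).m + (F.P K).K := by simp only [T4Family.P_K]; omega
  exact continuousOn_critCfgAxOfRecord_of_continuousOn_sel_of_ukExists ν hk hε hε3 hε2 hδ hnum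
    (fun W hW => ukExists_of_le_of_Uk_mem hlt.le (h11 W hW).1 (hreg8 W hW))
    (fun W hW => uniqueUkOrbit_of_le_of_Uk_mem hlt.le (h11 W hW).1 (hreg8 W hW) (h11 W hW).2)
    (continuousOn_critCfgSelOfRecord_of_thm1_of_reg8 ν K k hlt he hα hα3 hα2 hα24 hαL hk1 h11 hreg8)

/-- ★★ **dag-n09-w1 g5's TOWER BINDER `hcrit`, Ax EDITION OF RECORD, FROM THE TWO-RADII DOORS' BINDERS**: with the tower-shaped displayed shapes `h11` ([B11] Thm 1 ×2 at `εbg`, every level `k ≤ K`, on the small-field domains of record) and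
`hreg8` (the (8)-membership), the radii ordering `εreg < εbg` and the numerics of `continuousOn_critCfgAxOfRecord_of_thm1_of_reg8`: `∀ j < K, ContinuousOn (critCfgAxOfRecord F N ν K j) (domAltOfRecord F N ν K (j+1))`. [cite:
Balaban1987RG1, (2.3) p.265 and p.259; Balaban1985Variational, Thm 1 (6), (8) p.279] -/
theorem hcritAx_domAlt_of_thm1_εbg_of_reg8 (ν : Stage7Numerics) (εbg : ℝ) (K : ℕ) {α₀ δ : ℝ} (hlt : ν.εreg < εbg) (he : ν.εreg < α₀) (hα : 0 < α₀)
    (hα3 : (143 * (((((F.P K).d + 4 : ℕ) : ℝ)) ^ 2 / 4) ^ 2) * α₀ ≤ 1 / 3)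
    (hα2 : 2 * α₀ ≤ 2 * deltaSU (Fin N) / ((((F.P K).d + 4) * (F.P K).L : ℕ) : ℝ) ^ 2)
    (hα24 : ((((F.P K).d + 2) * (F.P K).L : ℕ) : ℝ) ^ 2 / 4 * (2 * α₀) ≤ 1 / 24)
    (hαL : 157 * (((((F.P K).d + 2) * (F.P K).L : ℕ) : ℝ) ^ 2 / 4 * (2 * α₀)) < (((F.P K).L : ℝ) ^ ((F.P K).d - 1))⁻¹)
    (hε : 0 < ν.εreg) (hε3 : (143 * (((((F.P K).d + 4 : ℕ) : ℝ)) ^ 2 / 4) ^ 2) * ν.εreg ≤ 1 / 3)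
    (hε2 : 2 * ν.εreg ≤ 2 * deltaSU (Fin N) / ((((F.P K).d + 4) * (F.P K).L : ℕ) : ℝ) ^ 2) (hδ : 2 * ν.εreg ≤ δ * ((F.P K).L : ℝ) ^ 2)
    (hnum : ((((F.P K).d * (F.P K).L : ℕ) : ℝ)) ^ 2 / 4 * δ < deltaFed (Fin N))
    (h11 : ∀ k, k ≤ K → ∀ V ∈ domAltOfRecord F N ν K k, UkExists F N K k εbg V ∧ UniqueUkOrbit F N K k εbg V)
    (hreg8 : ∀ k, k ≤ K → ∀ V ∈ domAltOfRecord F N ν K k, Uk F N K k εbg V ∈ bgReg F N K k ν.εreg) :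
    ∀ j < K, ContinuousOn (critCfgAxOfRecord F N ν K j) (domAltOfRecord F N ν K (j + 1)) :=
  fun j hj => continuousOn_critCfgAxOfRecord_of_thm1_of_reg8 ν hj hlt he hα hα3 hα2 hα24 hαL hε hε3 hε2 hδ hnum (h11 (j + 1) hj) (hreg8 (j + 1) hj)

/-- **The hinge as a level family on the small-field domains, same inputs**: `∀ j < K`, `critCfgAxOfRecord ν K j = axialize ∘ critCfgSelOfRecord ν K j` ON `domAlt_{j+1}`. [cite: Balaban1987RG1, (2.3) p.265 and p.259;
Balaban1985Variational, Thm 1 (6), (8) p.279] -/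
theorem eqOn_critCfgAxOfRecord_domAlt_of_thm1_εbg_of_reg8 (ν : Stage7Numerics) (εbg : ℝ) (K : ℕ) (hle : ν.εreg ≤ εbg)
    (h11 : ∀ k, k ≤ K → ∀ V ∈ domAltOfRecord F N ν K k, UkExists F N K k εbg V ∧ UniqueUkOrbit F N K k εbg V)
    (hreg8 : ∀ k, k ≤ K → ∀ V ∈ domAltOfRecord F N ν K k, Uk F N K k εbg V ∈ bgReg F N K k ν.εreg) :
    ∀ j < K, EqOn (critCfgAxOfRecord F N ν K j) (fun W => axialize (contourOfRecord F N K j) (critCfgSelOfRecord F N ν K j W))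
      (domAltOfRecord F N ν K (j + 1)) := by
  intro j hj
  have hk1 : j + 1 ≤ (F.P K).m + (F.P K).K := by simp only [T4Family.P_K]; omega
  exact eqOn_critCfgAxOfRecord_axialize_critCfgSel hk1 fun W hW =>
    uniqueUkOrbit_of_le_of_Uk_mem hle (h11 (j + 1) hj W hW).1 (hreg8 (j + 1) hj W hW) (h11 (j + 1) hj W hW).2
end Continuity

/-! ## §7  Road B's clauses for the NAMED letter in one sentence -/
section Package

variable {F : T4Family} {N : ℕ} [NeZero N]
/-- ★★★ **ROAD B's LETTER CLAUSES FOR THE NAMED `critCfgAxOfRecord ν K k` ON A TWO-RADII SET `D`** (hypotheses of `continuousOn_critCfgAxOfRecord_of_thm1_of_reg8`): (b) the fibre identity `M(V^{(k)}_{ax}(W)) = W` on `D`; (c) `AxialGauge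
(contourOfRecord F N K k) (V^{(k)}_{ax}(W))` for EVERY `W`; (d) block-lift covariance `V^{(k)}_{ax}(W^v) = (V^{(k)}_{ax}(W))^{v∘blockOf}` for `W ∈ D` with one orbit at `W^v` (radius `εreg`); (a′) `EqOn` with the MEASURABLE composite
`axialize ∘ V^{(k),Sel}` on `D` (global measurability of the named letter is §5's conditional theorem — the located note); (e) `∀ W ∈ D, PlaqSmall δ (V^{(k)}_{ax}(W))`; (f) `ContinuousOn (critCfgAxOfRecord ν K k) D`. [cite:
Balaban1987RG1, (2.1)–(2.4) pp.265–266, (2.9) p.266 and (2.16) p.269; Balaban1985Variational, Thm 1 (6), (8) p.279 and (181) p.307; Balaban1985Averaging, Prop. 2 (53) p.26] -/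
theorem critCfgAxOfRecord_roadB_clauses_of_thm1_of_reg8 (ν : Stage7Numerics) {K k : ℕ} (hk : k < K) {εbg α₀ δ : ℝ} (hlt : ν.εreg < εbg) (he : ν.εreg < α₀)
    (hα : 0 < α₀) (hα3 : (143 * (((((F.P K).d + 4 : ℕ) : ℝ)) ^ 2 / 4) ^ 2) * α₀ ≤ 1 / 3)
    (hα2 : 2 * α₀ ≤ 2 * deltaSU (Fin N) / ((((F.P K).d + 4) * (F.P K).L : ℕ) : ℝ) ^ 2)
    (hα24 : ((((F.P K).d + 2) * (F.P K).L : ℕ) : ℝ) ^ 2 / 4 * (2 * α₀) ≤ 1 / 24)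
    (hαL : 157 * (((((F.P K).d + 2) * (F.P K).L : ℕ) : ℝ) ^ 2 / 4 * (2 * α₀)) < (((F.P K).L : ℝ) ^ ((F.P K).d - 1))⁻¹)
    (hε : 0 < ν.εreg) (hε3 : (143 * (((((F.P K).d + 4 : ℕ) : ℝ)) ^ 2 / 4) ^ 2) * ν.εreg ≤ 1 / 3)
    (hε2 : 2 * ν.εreg ≤ 2 * deltaSU (Fin N) / ((((F.P K).d + 4) * (F.P K).L : ℕ) : ℝ) ^ 2) (hδ : 2 * ν.εreg ≤ δ * ((F.P K).L : ℝ) ^ 2)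
    (hnum : ((((F.P K).d * (F.P K).L : ℕ) : ℝ)) ^ 2 / 4 * δ < deltaFed (Fin N))
    {D : Set (GaugeField (F.P K) (k + 1) (SU N))}
    (h11 : ∀ W ∈ D, UkExists F N K (k + 1) εbg W ∧ UniqueUkOrbit F N K (k + 1) εbg W)
    (hreg8 : ∀ W ∈ D, Uk F N K (k + 1) εbg W ∈ bgReg F N K (k + 1) ν.εreg) :
    (∀ W ∈ D, (avOfRecord F N K k).avg (critCfgAxOfRecord F N ν K k W) = W) ∧
    (∀ W : GaugeField (F.P K) (k + 1) (SU N), AxialGauge (contourOfRecord F N K k) (critCfgAxOfRecord F N ν K k W)) ∧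
    (∀ (v : GaugeTransf (F.P K) (k + 1) (SU N)), ∀ W ∈ D, UniqueUkOrbit F N K (k + 1) ν.εreg (gaugeAct v W) →
      critCfgAxOfRecord F N ν K k (gaugeAct v W) = gaugeAct (liftTransf v) (critCfgAxOfRecord F N ν K k W)) ∧
    EqOn (critCfgAxOfRecord F N ν K k) (fun W => axialize (contourOfRecord F N K k) (critCfgSelOfRecord F N ν K k W)) D ∧
    (∀ W ∈ D, PlaqSmall δ (critCfgAxOfRecord F N ν K k W)) ∧
    ContinuousOn (critCfgAxOfRecord F N ν K k) D := by
  have hk1 : k + 1 ≤ (F.P K).m + (F.P K).K := by simp only [T4Family.P_K]; omega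
  have hsol : ∀ W ∈ D, UkExists F N K (k + 1) ν.εreg W := fun W hW => ukExists_of_le_of_Uk_mem hlt.le (h11 W hW).1 (hreg8 W hW)
  have huq : ∀ W ∈ D, UniqueUkOrbit F N K (k + 1) ν.εreg W := fun W hW =>
    uniqueUkOrbit_of_le_of_Uk_mem hlt.le (h11 W hW).1 (hreg8 W hW) (h11 W hW).2
  refine ⟨fun W hW => avg_critCfgAxOfRecord hk1 (hsol W hW), fun W => axialGauge_critCfgAxOfRecord hk1 W,
    fun v W hW huv => critCfgAxOfRecord_gaugeAct hk1 v (hsol W hW) huv, eqOn_critCfgAxOfRecord_axialize_critCfgSel hk1 huq,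
    fun W hW => plaqSmall_critCfgAxOfRecord_of_ukExists ν hε hε3 hε2 hδ (hsol W hW), ?_⟩
  exact continuousOn_critCfgAxOfRecord_of_thm1_of_reg8 ν hk hlt he hα hα3 hα2 hα24 hαL hε hε3 hε2 hδ hnum h11 hreg8
end Package

end Summit.QuantumFields.YangMills.BalabanUVNodes.N07CritCfgAxOfRecordClauses
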